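import Mathlib
import Summits.CriticalPhenomena.Ising3DConformalLimit.Theorems.MoebiusLimitOfTwoPointLaw.Negative.GroupLemmaNeedsTranslation
import HarnessLib

/-!
# Change of variables under the product sphere inversion (K2b helper, line `two-shell-exchange-markov`,
crux `MoebiusLimitOfTwoPointLaw`, item stmt-CriticalPhenomena-4801)

Write `ι_λ x = (λ/‖x‖²) x` (`λ > 0`) for the origin-centred sphere inversion of `ℝ³` and `Φ x = (ι_λ xᵢ)ᵢ` for its
product action on configurations `x : Fin n → ℝ³`. Proved here, `sorry`-free, for the registered stub K2b
(`stub_densityOfLawReversal`: moment densities of a sphere-inversion-reversible law are sphere-inversion covariant):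

* `hasFDerivAt_sphereInversion`, `abs_det_fderiv_sphereInversion`: `ι_λ` is differentiable off the origin with
  Jacobian `|det Dι_λ(y)| = (λ/‖y‖²)³` (`EuclideanGeometry.hasFDerivAt_inversion`, `Submodule.det_reflection`);
* `setIntegral_comp_prodSphereInversion`: `∫_{({0}ᶜ)ⁿ} g = ∫_{({0}ᶜ)ⁿ} (∏ᵢ (λ/‖xᵢ‖²)³) g(Φ x) dx` for every `g`
  (`MeasureTheory.integral_image_eq_integral_abs_det_fderiv_smul`, `ContinuousLinearMap.det_pi`; `Φ` is an
  injective involution of `({0}ᶜ)ⁿ`);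
* `integral_sphereInversion_transfer` (registered helper sub-goal): for test functions vanishing at the origin,
  `∫ T(x) ∏ᵢ (λ/‖xᵢ‖²)^{3−Δ} fᵢ(ι_λ xᵢ) dx = ∫ (T(Φ x) ∏ᵢ (λ/‖xᵢ‖²)^Δ) ∏ᵢ fᵢ(xᵢ) dx` — the left-hand side of the
  smeared reversibility identity of stub K2a, moved onto plain test functions.

References: Di Francesco–Mathieu–Sénéchal, *Conformal Field Theory* (1997) §4.3.1 (4.48)
[FrancescoMathieuSenechal1997].
-/

noncomputable section

namespace Summit.CriticalPhenomena.Ising3DConformalLimit.PrecisionLaplacianMoebiusLimitOfTwoPointLaw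

open Literature.Probability.LatticeModels Filter Topology MeasureTheory
open Summit.CriticalPhenomena.Ising3DConformalLimit.Theorems.MoebiusLimitOfTwoPointLaw.Negative
  (sphereInversion_eq_smul_inversion norm_sphereInversion sphereInversion_injective)

/-! ## The sphere inversion `ι_λ`: involution, derivative, Jacobian -/

/-- `ι_λ` is an involution on nonzero vectors. -/
theorem sphereInversion_sphereInversion {lam : ℝ} (hlam : 0 < lam) {y : EuclideanSpace ℝ (Fin 3)}
    (hy : y ≠ 0) : (lam / ‖(lam / ‖y‖ ^ 2) • y‖ ^ 2) • (lam / ‖y‖ ^ 2) • y = y := by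
  rw [norm_sphereInversion hlam hy, smul_smul]
  have hn : 0 < ‖y‖ := norm_pos_iff.2 hy
  rw [show lam / (lam / ‖y‖) ^ 2 * (lam / ‖y‖ ^ 2) = 1 by field_simp, one_smul]

/-- The conformal factor at the image point: `λ/‖ι_λ y‖² = (λ/‖y‖²)⁻¹`. -/
theorem coef_sphereInversion {lam : ℝ} (hlam : 0 < lam) {y : EuclideanSpace ℝ (Fin 3)} (hy : y ≠ 0) :
    lam / ‖(lam / ‖y‖ ^ 2) • y‖ ^ 2 = (lam / ‖y‖ ^ 2)⁻¹ := by
  rw [norm_sphereInversion hlam hy]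
  have hn : 0 < ‖y‖ := norm_pos_iff.2 hy
  field_simp

/-- `ι_λ` maps nonzero vectors to nonzero vectors. -/
theorem sphereInversion_ne_zero {lam : ℝ} (hlam : 0 < lam) {y : EuclideanSpace ℝ (Fin 3)} (hy : y ≠ 0) :
    (lam / ‖y‖ ^ 2) • y ≠ 0 := by
  have hn : 0 < ‖y‖ := norm_pos_iff.2 hy
  exact smul_ne_zero (by positivity) hy

/-- Fréchet derivative of `ι_λ` at `y ≠ 0` (from `EuclideanGeometry.hasFDerivAt_inversion`, `ι_λ = λ • ι`). -/
theorem hasFDerivAt_sphereInversion (lam : ℝ) {y : EuclideanSpace ℝ (Fin 3)} (hy : y ≠ 0) :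
    HasFDerivAt (fun x : EuclideanSpace ℝ (Fin 3) => (lam / ‖x‖ ^ 2) • x)
      (lam • ((1 / dist y 0) ^ 2 •
        ((ℝ ∙ (y - 0))ᗮ.reflection : EuclideanSpace ℝ (Fin 3) →L[ℝ] EuclideanSpace ℝ (Fin 3)))) y := by
  have h := (EuclideanGeometry.hasFDerivAt_inversion (c := (0 : EuclideanSpace ℝ (Fin 3))) (R := 1)
    hy).const_smul lam
  have hfun : (fun x : EuclideanSpace ℝ (Fin 3) => (lam / ‖x‖ ^ 2) • x) =
      fun x => lam • EuclideanGeometry.inversion 0 1 x :=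
    funext (sphereInversion_eq_smul_inversion lam)
  rw [hfun]; exact h

/-- Jacobian of `ι_λ` at `y ≠ 0`: `|det Dι_λ(y)| = (λ/‖y‖²)³` (`|det reflection| = 1`). -/
theorem abs_det_fderiv_sphereInversion {lam : ℝ} (hlam : 0 < lam) {y : EuclideanSpace ℝ (Fin 3)}
    (hy : y ≠ 0) :
    |(lam • ((1 / dist y 0) ^ 2 •
        ((ℝ ∙ (y - 0))ᗮ.reflection : EuclideanSpace ℝ (Fin 3) →L[ℝ] EuclideanSpace ℝ (Fin 3)))).det|
      = (lam / ‖y‖ ^ 2) ^ 3 := by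
  simp only [ContinuousLinearMap.det, ContinuousLinearMap.toLinearMap_smul, LinearMap.det_smul,
    finrank_euclideanSpace_fin]
  have hR : |LinearMap.det (((ℝ ∙ (y - 0))ᗮ.reflection :
      EuclideanSpace ℝ (Fin 3) →L[ℝ] EuclideanSpace ℝ (Fin 3)) :
        EuclideanSpace ℝ (Fin 3) →ₗ[ℝ] EuclideanSpace ℝ (Fin 3))| = 1 := by
    have := ((ℝ ∙ (y - 0))ᗮ).det_reflection
    rw [show (((ℝ ∙ (y - 0))ᗮ.reflection : EuclideanSpace ℝ (Fin 3) →L[ℝ] EuclideanSpace ℝ (Fin 3)) :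
        EuclideanSpace ℝ (Fin 3) →ₗ[ℝ] EuclideanSpace ℝ (Fin 3))
        = ↑((ℝ ∙ (y - 0))ᗮ).reflection.toLinearEquiv from rfl, this]
    simp
  rw [abs_mul, abs_mul, hR, mul_one, dist_zero_right]
  have hn : 0 < ‖y‖ := norm_pos_iff.2 hy
  rw [abs_of_pos (pow_pos hlam 3), abs_of_nonneg (by positivity)]
  field_simp

/-! ## The product map `Φ` on `({0}ᶜ)ⁿ` and the change of variables -/

/-- Fréchet derivative of the product sphere inversion `Φ` at an off-origin configuration. -/
theorem hasFDerivAt_prodSphereInversion (n : ℕ) (lam : ℝ) {z : Fin n → EuclideanSpace ℝ (Fin 3)}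
    (hz : ∀ i, z i ≠ 0) :
    HasFDerivAt (fun (x : Fin n → EuclideanSpace ℝ (Fin 3)) i => (lam / ‖x i‖ ^ 2) • x i)
      (ContinuousLinearMap.pi fun i =>
        (lam • ((1 / dist (z i) 0) ^ 2 • ((ℝ ∙ (z i - 0))ᗮ.reflection :
          EuclideanSpace ℝ (Fin 3) →L[ℝ] EuclideanSpace ℝ (Fin 3)))).comp (ContinuousLinearMap.proj i)) z := by
  refine hasFDerivAt_pi.2 fun i => ?_
  exact HasFDerivAt.comp (f := fun x : Fin n → EuclideanSpace ℝ (Fin 3) => x i) z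
    (hasFDerivAt_sphereInversion lam (hz i)) (hasFDerivAt_apply i z)

/-- Jacobian of `Φ`: `|det DΦ(z)| = ∏ᵢ (λ/‖zᵢ‖²)³` (`ContinuousLinearMap.det_pi`). -/
theorem abs_det_fderiv_prodSphereInversion (n : ℕ) {lam : ℝ} (hlam : 0 < lam)
    {z : Fin n → EuclideanSpace ℝ (Fin 3)} (hz : ∀ i, z i ≠ 0) :
    |(ContinuousLinearMap.pi fun i =>
        (lam • ((1 / dist (z i) 0) ^ 2 • ((ℝ ∙ (z i - 0))ᗮ.reflection :
          EuclideanSpace ℝ (Fin 3) →L[ℝ] EuclideanSpace ℝ (Fin 3)))).comp (ContinuousLinearMap.proj i)).det|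
      = ∏ i, (lam / ‖z i‖ ^ 2) ^ 3 := by
  rw [ContinuousLinearMap.det_pi, Finset.abs_prod]
  exact Finset.prod_congr rfl fun i _ => abs_det_fderiv_sphereInversion hlam (hz i)

/-- The set `({0}ᶜ)ⁿ` of off-origin configurations is open. -/
theorem isOpen_forall_ne_zero (n : ℕ) : IsOpen {x : Fin n → EuclideanSpace ℝ (Fin 3) | ∀ i, x i ≠ 0} := by
  rw [Set.setOf_forall]
  exact isOpen_iInter_of_finite fun i => isOpen_compl_singleton.preimage (continuous_apply i)

/-- **Change of variables for the product sphere inversion.** For every `g` (no measurability needed),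
`∫_{({0}ᶜ)ⁿ} g = ∫_{({0}ᶜ)ⁿ} (∏ᵢ (λ/‖xᵢ‖²)³) g(Φ x) dx` (`Φ` is an injective involution of `({0}ᶜ)ⁿ`). -/
theorem setIntegral_comp_prodSphereInversion (n : ℕ) {lam : ℝ} (hlam : 0 < lam)
    (g : (Fin n → EuclideanSpace ℝ (Fin 3)) → ℝ) :
    ∫ x in {x : Fin n → EuclideanSpace ℝ (Fin 3) | ∀ i, x i ≠ 0}, g x =
      ∫ x in {x : Fin n → EuclideanSpace ℝ (Fin 3) | ∀ i, x i ≠ 0},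
        (∏ i, (lam / ‖x i‖ ^ 2) ^ 3) * g (fun i => (lam / ‖x i‖ ^ 2) • x i) := by
  have hU : MeasurableSet {x : Fin n → EuclideanSpace ℝ (Fin 3) | ∀ i, x i ≠ 0} :=
    (isOpen_forall_ne_zero n).measurableSet
  have himage : (fun (x : Fin n → EuclideanSpace ℝ (Fin 3)) i => (lam / ‖x i‖ ^ 2) • x i) ''
      {x | ∀ i, x i ≠ 0} = {x | ∀ i, x i ≠ 0} := by
    apply Set.Subset.antisymm
    · rintro _ ⟨z, hz, rfl⟩ i
      exact sphereInversion_ne_zero hlam (hz i)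
    · intro x hx
      exact ⟨fun i => (lam / ‖x i‖ ^ 2) • x i, fun i => sphereInversion_ne_zero hlam (hx i),
        funext fun i => sphereInversion_sphereInversion hlam (hx i)⟩
  have hinj : Set.InjOn (fun (x : Fin n → EuclideanSpace ℝ (Fin 3)) i => (lam / ‖x i‖ ^ 2) • x i)
      {x | ∀ i, x i ≠ 0} := by
    intro x _ y _ hxy
    exact funext fun i => sphereInversion_injective hlam.ne' (congr_fun hxy i)
  have h := integral_image_eq_integral_abs_det_fderiv_smul volume hU
    (fun z hz => (hasFDerivAt_prodSphereInversion n lam hz).hasFDerivWithinAt) hinj g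
  rw [himage] at h; rw [h]
  refine setIntegral_congr_fun hU fun z hz => ?_
  simp only [smul_eq_mul]
  rw [abs_det_fderiv_prodSphereInversion n hlam hz]

/-- Whole-space integrals of functions vanishing off `({0}ᶜ)ⁿ` are integrals over `({0}ᶜ)ⁿ`; used to compare two
such integrals through the change of variables. -/
theorem integral_eq_of_setIntegral_forall_ne_zero {n : ℕ} (F G : (Fin n → EuclideanSpace ℝ (Fin 3)) → ℝ)
    (hF : ∀ x : Fin n → EuclideanSpace ℝ (Fin 3), x ∉ {x | ∀ i, x i ≠ 0} → F x = 0)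
    (hG : ∀ x : Fin n → EuclideanSpace ℝ (Fin 3), x ∉ {x | ∀ i, x i ≠ 0} → G x = 0)
    (h : ∫ x in {x : Fin n → EuclideanSpace ℝ (Fin 3) | ∀ i, x i ≠ 0}, F x =
      ∫ x in {x : Fin n → EuclideanSpace ℝ (Fin 3) | ∀ i, x i ≠ 0}, G x) :
    ∫ x, F x = ∫ x, G x := by
  rw [← setIntegral_eq_integral_of_forall_compl_eq_zero hF, ← setIntegral_eq_integral_of_forall_compl_eq_zero hG]
  exact h

/-- **Transfer of the smeared identity (registered K2b helper).** For test functions vanishing at the origin, the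
left-hand side of the reversibility identity equals `∫ (T(Φ x) ∏ᵢ (λ/‖xᵢ‖²)^Δ) ∏ᵢ fᵢ(xᵢ) dx` (change of variables
`y = Φ x`, `ι_λ ∘ ι_λ = id`, `(λ/‖xᵢ‖²)³ · ((λ/‖xᵢ‖²)⁻¹)^{3−Δ} = (λ/‖xᵢ‖²)^Δ`). -/
theorem integral_sphereInversion_transfer :
    ∀ (n : ℕ) (lam : ℝ), 0 < lam → ∀ (Δ : ℝ) (T : (Fin n → EuclideanSpace ℝ (Fin 3)) → ℝ)
      (f : Fin n → EuclideanSpace ℝ (Fin 3) → ℝ), (∀ i, f i 0 = 0) →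
      (∫ x : Fin n → EuclideanSpace ℝ (Fin 3),
          T x * ∏ i, ((lam / ‖x i‖ ^ 2) ^ ((3 : ℝ) - Δ) * f i ((lam / ‖x i‖ ^ 2) • x i))) =
        ∫ x : Fin n → EuclideanSpace ℝ (Fin 3),
          (T (fun i => (lam / ‖x i‖ ^ 2) • x i) * ∏ i, (lam / ‖x i‖ ^ 2) ^ Δ) * ∏ i, f i (x i) := by
  intro n lam hlam Δ T f hf0
  refine integral_eq_of_setIntegral_forall_ne_zero _ _ (fun x hx => ?_) (fun x hx => ?_) ?_
  · obtain ⟨i, hi⟩ : ∃ i, x i = 0 := by simpa using hx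
    rw [Finset.prod_eq_zero (Finset.mem_univ i) (by rw [hi, smul_zero, hf0, mul_zero]), mul_zero]
  · obtain ⟨i, hi⟩ : ∃ i, x i = 0 := by simpa using hx
    rw [show ∏ i, f i (x i) = 0 from Finset.prod_eq_zero (Finset.mem_univ i) (by rw [hi, hf0]), mul_zero]
  rw [setIntegral_comp_prodSphereInversion n hlam]
  refine setIntegral_congr_fun (isOpen_forall_ne_zero n).measurableSet fun x hx => ?_
  have hx' : ∀ i, x i ≠ 0 := hx
  have h1 : ∏ i, ((lam / ‖(lam / ‖x i‖ ^ 2) • x i‖ ^ 2) ^ ((3 : ℝ) - Δ) *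
      f i ((lam / ‖(lam / ‖x i‖ ^ 2) • x i‖ ^ 2) • (lam / ‖x i‖ ^ 2) • x i)) =
      ∏ i, (((lam / ‖x i‖ ^ 2)⁻¹) ^ ((3 : ℝ) - Δ) * f i (x i)) :=
    Finset.prod_congr rfl fun i _ => by
      rw [sphereInversion_sphereInversion hlam (hx' i), coef_sphereInversion hlam (hx' i)]
  have h2 : (∏ i, (lam / ‖x i‖ ^ 2) ^ 3) * ∏ i, ((lam / ‖x i‖ ^ 2)⁻¹) ^ ((3 : ℝ) - Δ) =
      ∏ i, (lam / ‖x i‖ ^ 2) ^ Δ := by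
    rw [← Finset.prod_mul_distrib]
    refine Finset.prod_congr rfl fun i _ => ?_
    have ha : 0 < lam / ‖x i‖ ^ 2 := by
      have := norm_pos_iff.2 (hx' i); positivity
    rw [Real.inv_rpow ha.le, ← Real.rpow_neg ha.le, ← Real.rpow_ofNat, ← Real.rpow_add ha]
    norm_num
  simp only
  rw [h1, Finset.prod_mul_distrib, ← h2]
  ring

end Summit.CriticalPhenomena.Ising3DConformalLimit.PrecisionLaplacianMoebiusLimitOfTwoPointLaw
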